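import Mathlib
import Literature.Computability.AlgebraicComplexity.NewtonPolygonTauProductBounds
import Summits.ValiantsHypothesis.ValiantsHypothesis.Theorems.NewtonUnitEquationsDissociatedUniformTotalsLawChartTops
import Summits.ValiantsHypothesis.ValiantsHypothesis.Theorems.NewtonUnitEquationsDissociatedUniformTotalsLawHeights
import HarnessLib

/-!
# Crux `NewtonUnitEquations.DissociatedUniform` (stmt-ValiantsHypothesis-5905): the `n = 3` totals law — LATTICE CHARTS
# (restricted half-charts `|t| ≤ 1`; along one of them an integer point set of height extent `≤ (J+1)³` has `≤ 3(J+1)² + 1` tops)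

Memo `Cruxes/DissociatedUniform/NOTES-t1g17.md` §2; companion of `…TotalsLawHeights` (height monotonicity of chart tops,
`snd_lt_snd_of_isStrictTop`) and consumed by `…TotalsLawLattice` (the Jarník-type vertex bound and the lattice stratum of the law).
For a finite set `F` of INTEGER points:
* restrict the half-chart `(σ, t)` to `|t| ≤ 1` (the covering of all hull vertices by the four restricted half-charts of `F` and of
  its coordinate swap is in `…TotalsLawLattice`);
* along the restricted half-chart send each top `p` (except the highest) to the integer vector `succ p − p` to the top of next
  height: these vectors are pairwise DISTINCT (the advantage `σ v₀ + t v₁` of `p + v` over `p` is affine increasing in `t`,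
  negative at the time of `p`, positive at the time of `succ p` — two tops with the same `v` would interleave), STEEP
  (`|v₀| ≤ v₁`, from `|t| ≤ 1`), and their heights `v₁ ≥ 1` tile disjoint integer intervals, so `Σ v₁ ≤` the height extent `N`;
* `card_mul_le_of_steep`: distinct steep integer vectors with `Σ v₁ ≤ N ≤ (J+1)³` number `≤ 3(J+1)²` (those with `v₁ ≤ J` are
  `≤ (2J+1)J`, the others contribute `≥ J+1` each).
Hence **`card_restrictedTops_le`**: `≤ 3(J+1)² + 1` strict tops per restricted half-chart.
Honest label: elementary planar lattice bookkeeping; `TotalsLawThree C` remains OPEN and is asserted nowhere; nothing here bears on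
VP ≠ VNP.
[folklore: a convex lattice polygon in a box of side M has O(M^{2/3}) vertices (Jarník 1926; Andrews 1963)]
-/

set_option linter.dupNamespace false -- `ValiantsHypothesis.ValiantsHypothesis` (summit = problem) in every name

open Matrix Finset
open scoped BigOperators Pointwise

namespace Summit.ValiantsHypothesis.ValiantsHypothesis.Theorems.NewtonUnitEquationsDissociatedUniform

namespace TotalsLaw

open Literature.Computability.AlgebraicComplexity.KPTT.PlanarMinkowski

/-! ### Counting distinct steep integer vectors -/

/-- **Distinct steep integer vectors.**  If every `v ∈ D ⊂ ℤ²` has `1 ≤ v₂` and `|v₁| ≤ v₂`, then for every `J`,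
`(J+1)·#D ≤ (J+1)(2J+1)J + Σ_{v∈D} v₂`: the vectors with `v₂ ≤ J` lie in the box `[-J, J] × [1, J]`, the others have `v₂ ≥ J+1`.
[folklore] -/
theorem card_mul_le_of_steep (D : Finset (ℤ × ℤ)) (hD : ∀ v ∈ D, 1 ≤ v.2 ∧ |v.1| ≤ v.2) (J : ℕ) :
    ((J : ℤ) + 1) * D.card ≤ ((J : ℤ) + 1) * ((2 * J + 1) * J : ℕ) + ∑ v ∈ D, v.2 := by
  classical
  set Ds := D.filter fun v => v.2 ≤ (J : ℤ) with hDs_def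
  set Db := D.filter fun v => ¬ v.2 ≤ (J : ℤ) with hDb_def
  have hsplit : D.card = Ds.card + Db.card := (Finset.card_filter_add_card_filter_not _).symm
  have hDs : Ds.card ≤ (2 * J + 1) * J := by
    have hsub : Ds ⊆ (Finset.Icc (-(J : ℤ)) J) ×ˢ (Finset.Icc (1 : ℤ) J) := by
      intro v hv
      obtain ⟨hvD, hvJ⟩ := Finset.mem_filter.1 hv
      obtain ⟨h1, h2⟩ := hD v hvD
      rw [Finset.mem_product, Finset.mem_Icc, Finset.mem_Icc]
      refine ⟨⟨?_, ?_⟩, h1, hvJ⟩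
      · have := neg_abs_le v.1; linarith
      · have := le_abs_self v.1; linarith
    refine (Finset.card_le_card hsub).trans ?_
    rw [Finset.card_product, Int.card_Icc, Int.card_Icc]
    have e1 : ((J : ℤ) + 1 - -(J : ℤ)).toNat = 2 * J + 1 := by
      have : ((J : ℤ) + 1 - -(J : ℤ)) = ((2 * J + 1 : ℕ) : ℤ) := by push_cast; ring
      rw [this, Int.toNat_natCast]
    have e2 : ((J : ℤ) + 1 - 1).toNat = J := by simp
    rw [e1, e2]
  have hDb : ((J : ℤ) + 1) * Db.card ≤ ∑ v ∈ Db, v.2 := by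
    calc ((J : ℤ) + 1) * Db.card = ∑ _v ∈ Db, ((J : ℤ) + 1) := by rw [Finset.sum_const, nsmul_eq_mul]; ring
      _ ≤ ∑ v ∈ Db, v.2 := Finset.sum_le_sum fun v hv => by
          have := (Finset.mem_filter.1 hv).2
          push Not at this
          omega
  have hsum : ∑ v ∈ Db, v.2 ≤ ∑ v ∈ D, v.2 :=
    Finset.sum_le_sum_of_subset_of_nonneg (Finset.filter_subset _ _) fun v hv _ => by linarith [(hD v hv).1]
  have hDs' : ((J : ℤ) + 1) * Ds.card ≤ ((J : ℤ) + 1) * ((2 * J + 1) * J : ℕ) :=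
    mul_le_mul_of_nonneg_left (by exact_mod_cast hDs) (by positivity)
  rw [hsplit]
  push_cast at hDs' ⊢
  have hmul : ((J : ℤ) + 1) * ((Ds.card : ℤ) + Db.card) = ((J : ℤ) + 1) * Ds.card + ((J : ℤ) + 1) * Db.card := by ring
  rw [hmul]
  linarith

/-! ### The count along one restricted half-chart for integer point sets -/

open Classical in
/-- **Restricted half-chart count for integer sets.**  If `F ⊂ ℤ²` (cast to `ℝ²`) has height extent `≤ N ≤ (J+1)³`, then along
the restricted half-chart `(σ, t)`, `σ = ±1`, `|t| ≤ 1`, it has at most `3(J+1)² + 1` strict tops: the successor-difference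
vectors of the tops are distinct, steep, integral, and their heights tile disjoint sub-intervals of the height range. [folklore] -/
theorem card_restrictedTops_le {σ : ℝ} (hσ : σ = 1 ∨ σ = -1) (F : Finset (Fin 2 → ℝ)) (N J : ℕ)
    (hint : ∀ x ∈ F, ∃ z : ℤ × ℤ, x 0 = z.1 ∧ x 1 = z.2) (hN : ∀ x ∈ F, ∀ y ∈ F, x 1 - y 1 ≤ N)
    (hJ : N ≤ (J + 1) ^ 3) :
    (F.filter fun x => ∃ t : ℝ, |t| ≤ 1 ∧ IsStrictTop ![σ, t] F x).card ≤ 3 * (J + 1) ^ 2 + 1 := by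
  classical
  set R := F.filter fun x => ∃ t : ℝ, |t| ≤ 1 ∧ IsStrictTop ![σ, t] F x with hR_def
  rcases R.eq_empty_or_nonempty with hR0 | hRne
  · rw [hR0]; simp
  have hRF : ∀ p ∈ R, p ∈ F := fun p hp => (Finset.mem_filter.1 hp).1
  -- integer coordinates
  have hZex : ∃ Z : (Fin 2 → ℝ) → ℤ × ℤ, ∀ x ∈ F, x 0 = (Z x).1 ∧ x 1 = (Z x).2 :=
    ⟨fun x => if h : x ∈ F then Classical.choose (hint x h) else 0, fun x hx => by
      simp only [dif_pos hx]; exact Classical.choose_spec (hint x hx)⟩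
  obtain ⟨Z, hZ⟩ := hZex
  -- top times in `[-1, 1]`
  have hτex : ∃ τ : (Fin 2 → ℝ) → ℝ, ∀ p ∈ R, |τ p| ≤ 1 ∧ IsStrictTop ![σ, τ p] F p :=
    ⟨fun p => if h : ∃ t : ℝ, |t| ≤ 1 ∧ IsStrictTop ![σ, t] F p then Classical.choose h else 0, fun p hp => by
      have h := (Finset.mem_filter.1 hp).2
      simp only [dif_pos h]; exact Classical.choose_spec h⟩
  obtain ⟨τ, hτ⟩ := hτex
  -- heights are injective on tops, and height order is time order
  have hinjh : ∀ p ∈ R, ∀ r ∈ R, p 1 = r 1 → p = r := by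
    intro p hp r hr h
    by_contra hne
    exact snd_ne_snd_of_isStrictTop (hτ p hp).2 (hτ r hr).2 hne h
  have hlt : ∀ p ∈ R, ∀ r ∈ R, p 1 < r 1 → τ p < τ r := by
    intro p hp r hr h
    rcases lt_trichotomy (τ p) (τ r) with hh | hh | hh
    · exact hh
    · exfalso
      have k := (hτ r hr).2
      rw [← hh] at k
      have : p = r := (hτ p hp).2.unique k
      rw [this] at h
      exact lt_irrefl _ h
    · exfalso
      have hne : r ≠ p := fun e => by rw [e] at h; exact lt_irrefl _ h
      have := snd_lt_snd_of_isStrictTop (hτ r hr).2 (hτ p hp).2 hne hh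
      linarith
  -- the highest top and the others
  obtain ⟨pm, hpm, hpmax⟩ := R.exists_max_image (fun p => p 1) hRne
  set R' := R.erase pm with hR'_def
  have hR'R : ∀ p ∈ R', p ∈ R := fun p hp => Finset.mem_of_mem_erase hp
  have hltpm : ∀ p ∈ R', p 1 < pm 1 := by
    intro p hp
    have hne : p ≠ pm := Finset.ne_of_mem_erase hp
    exact lt_of_le_of_ne (hpmax p (hR'R p hp)) fun h => hne (hinjh p (hR'R p hp) pm hpm h)
  -- successor (next height) of a non-highest top
  have key : ∀ p ∈ R', ∃ s, s ∈ R ∧ p 1 < s 1 ∧ ∀ r ∈ R, p 1 < r 1 → s 1 ≤ r 1 := by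
    intro p hp
    have hne : (R.filter fun r => p 1 < r 1).Nonempty := ⟨pm, Finset.mem_filter.2 ⟨hpm, hltpm p hp⟩⟩
    obtain ⟨s, hs, hsmin⟩ := Finset.exists_min_image _ (fun r => r 1) hne
    exact ⟨s, (Finset.mem_filter.1 hs).1, (Finset.mem_filter.1 hs).2,
      fun r hr hpr => hsmin r (Finset.mem_filter.2 ⟨hr, hpr⟩)⟩
  have hsuccex : ∃ succ : (Fin 2 → ℝ) → (Fin 2 → ℝ), ∀ p ∈ R', succ p ∈ R ∧ p 1 < succ p 1 ∧
      ∀ r ∈ R, p 1 < r 1 → succ p 1 ≤ r 1 :=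
    ⟨fun p => if h : p ∈ R' then Classical.choose (key p h) else p, fun p hp => by
      simp only [dif_pos hp]; exact Classical.choose_spec (key p hp)⟩
  obtain ⟨succ, hsucc⟩ := hsuccex
  -- sign pattern of the advantage `σ v₀ + t v₁` of `succ p` over `p`
  have hsign : ∀ p ∈ R', σ * (succ p 0 - p 0) + τ p * (succ p 1 - p 1) < 0 ∧
      0 < σ * (succ p 0 - p 0) + τ (succ p) * (succ p 1 - p 1) := by
    intro p hp
    obtain ⟨hs, h1, -⟩ := hsucc p hp
    have hpR := hR'R p hp
    have hne : succ p ≠ p := fun h => by rw [h] at h1; exact lt_irrefl _ h1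
    have e1 := (hτ p hpR).2.lt (hRF _ hs) hne
    have e2 := (hτ _ hs).2.lt (hRF _ hpR) hne.symm
    simp only [chart_dotProduct] at e1 e2
    constructor <;> linarith
  -- the integer successor-difference vectors
  set V : (Fin 2 → ℝ) → ℤ × ℤ := fun p => ((Z (succ p)).1 - (Z p).1, (Z (succ p)).2 - (Z p).2) with hV_def
  have hVre : ∀ p ∈ R', ((V p).1 : ℝ) = succ p 0 - p 0 ∧ ((V p).2 : ℝ) = succ p 1 - p 1 := by
    intro p hp
    have h1 := hZ p (hRF p (hR'R p hp))
    have h2 := hZ (succ p) (hRF _ (hsucc p hp).1)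
    simp only [hV_def]
    push_cast
    rw [h1.1, h1.2, h2.1, h2.2]
    exact ⟨rfl, rfl⟩
  -- steepness
  have hsteep : ∀ p ∈ R', 1 ≤ (V p).2 ∧ |(V p).1| ≤ (V p).2 := by
    intro p hp
    obtain ⟨hs, h1, -⟩ := hsucc p hp
    obtain ⟨e1, e2⟩ := hsign p hp
    obtain ⟨hv1, hv2⟩ := hVre p hp
    have ht1 := abs_le.1 (hτ p (hR'R p hp)).1
    have ht2 := abs_le.1 (hτ _ hs).1
    have hpos : (0 : ℝ) < succ p 1 - p 1 := by linarith
    have k1 : 0 ≤ (1 + τ p) * (succ p 1 - p 1) := mul_nonneg (by linarith) hpos.le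
    have k2 : 0 ≤ (1 - τ (succ p)) * (succ p 1 - p 1) := mul_nonneg (by linarith) hpos.le
    have habs : |succ p 0 - p 0| ≤ succ p 1 - p 1 := by
      rcases hσ with rfl | rfl
      · rw [abs_le]; constructor <;> nlinarith
      · rw [abs_le]; constructor <;> nlinarith
    constructor
    · have : (0 : ℝ) < (V p).2 := by rw [hv2]; exact hpos
      have : (0 : ℤ) < (V p).2 := by exact_mod_cast this
      omega
    · have : |((V p).1 : ℝ)| ≤ (V p).2 := by rw [hv1, hv2]; exact habs
      exact_mod_cast this
  -- injectivity
  have hVinj : Set.InjOn V (R' : Set (Fin 2 → ℝ)) := by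
    -- one-sided version
    have aux : ∀ p ∈ R', ∀ r ∈ R', V p = V r → p 1 < r 1 → False := by
      intro p hp r hr hVeq hpr
      obtain ⟨hps, hp1, hpmin⟩ := hsucc p hp
      obtain ⟨hrs, hr1, -⟩ := hsucc r hr
      obtain ⟨-, ep⟩ := hsign p hp
      obtain ⟨er, -⟩ := hsign r hr
      obtain ⟨vp1, vp2⟩ := hVre p hp
      obtain ⟨vr1, vr2⟩ := hVre r hr
      have hd0 : succ p 0 - p 0 = succ r 0 - r 0 := by rw [← vp1, ← vr1, hVeq]
      have hd1 : succ p 1 - p 1 = succ r 1 - r 1 := by rw [← vp2, ← vr2, hVeq]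
      -- `τ (succ p) ≤ τ r`
      have hle1 : succ p 1 ≤ r 1 := hpmin r (hR'R r hr) hpr
      have hτle : τ (succ p) ≤ τ r := by
        rcases hle1.lt_or_eq with hl | he
        · exact (hlt _ hps r (hR'R r hr) hl).le
        · rw [hinjh _ hps r (hR'R r hr) he]
      have hpos : 0 < succ p 1 - p 1 := by linarith
      rw [hd0, hd1] at ep
      rw [hd1] at hpos
      have : τ (succ p) * (succ r 1 - r 1) ≤ τ r * (succ r 1 - r 1) := mul_le_mul_of_nonneg_right hτle hpos.le
      linarith
    intro p hp r hr hVeq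
    have hp' := Finset.mem_coe.1 hp
    have hr' := Finset.mem_coe.1 hr
    by_contra hne
    rcases lt_trichotomy (p 1) (r 1) with h | h | h
    · exact aux p hp' r hr' hVeq h
    · exact hne (hinjh p (hR'R p hp') r (hR'R r hr') h)
    · exact aux r hr' p hp' hVeq.symm h
  -- disjoint height intervals: `Σ_{p ∈ R'} (V p)₂ ≤ N`
  have hsumle : ∑ p ∈ R', (V p).2 ≤ N := by
    set H : (Fin 2 → ℝ) → ℤ := fun p => (Z p).2 with hH_def
    have hHre : ∀ p ∈ R, ((H p : ℤ) : ℝ) = p 1 := fun p hp => by rw [hH_def]; exact (hZ p (hRF p hp)).2.symm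
    have hHlt : ∀ p ∈ R, ∀ r ∈ R, p 1 < r 1 → H p < H r := fun p hp r hr h => by
      have : ((H p : ℤ) : ℝ) < H r := by rw [hHre p hp, hHre r hr]; exact h
      exact_mod_cast this
    have hHle : ∀ p ∈ R, ∀ r ∈ R, p 1 ≤ r 1 → H p ≤ H r := fun p hp r hr h => by
      have : ((H p : ℤ) : ℝ) ≤ H r := by rw [hHre p hp, hHre r hr]; exact h
      exact_mod_cast this
    set I : (Fin 2 → ℝ) → Finset ℤ := fun p => Finset.Ioc (H p) (H (succ p)) with hI_def
    have hdisj : (R' : Set (Fin 2 → ℝ)).PairwiseDisjoint I := by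
      have aux : ∀ p ∈ R', ∀ r ∈ R', p 1 < r 1 → Disjoint (I p) (I r) := by
        intro p hp r hr hpr
        have hle1 : H (succ p) ≤ H r := hHle _ (hsucc p hp).1 r (hR'R r hr) ((hsucc p hp).2.2 r (hR'R r hr) hpr)
        rw [Finset.disjoint_left]
        intro k hk hk'
        rw [hI_def, Finset.mem_Ioc] at hk hk'
        omega
      intro p hp r hr hne
      have hp' := Finset.mem_coe.1 hp
      have hr' := Finset.mem_coe.1 hr
      rcases lt_trichotomy (p 1) (r 1) with h | h | h
      · exact aux p hp' r hr' h
      · exact absurd (hinjh p (hR'R p hp') r (hR'R r hr') h) hne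
      · exact (aux r hr' p hp' h).symm
    have hsub : R'.biUnion I ⊆ Finset.Ioc (H pm - N) (H pm) := by
      intro k hk
      obtain ⟨p, hp, hkp⟩ := Finset.mem_biUnion.1 hk
      rw [hI_def, Finset.mem_Ioc] at hkp
      rw [Finset.mem_Ioc]
      have h1 : H (succ p) ≤ H pm := hHle _ (hsucc p hp).1 pm hpm (hpmax _ (hsucc p hp).1)
      have h2 : H pm - N ≤ H p := by
        have e := hN pm (hRF pm hpm) p (hRF p (hR'R p hp))
        have : ((H pm : ℤ) : ℝ) - N ≤ H p := by rw [hHre pm hpm, hHre p (hR'R p hp)]; linarith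
        exact_mod_cast this
      omega
    have hcard : ((R'.biUnion I).card : ℤ) ≤ N := by
      have := Finset.card_le_card hsub
      rw [Int.card_Ioc] at this
      have e : (H pm - (H pm - N)).toNat = N := by simp
      rw [e] at this
      exact_mod_cast this
    calc ∑ p ∈ R', (V p).2 = ∑ p ∈ R', ((I p).card : ℤ) := by
          refine Finset.sum_congr rfl fun p hp => ?_
          rw [hI_def, Int.card_Ioc_of_le _ _ (hHlt p (hR'R p hp) _ (hsucc p hp).1 (hsucc p hp).2.1).le]
      _ = ((R'.biUnion I).card : ℤ) := by rw [Finset.card_biUnion hdisj]; push_cast; rfl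
      _ ≤ N := hcard
  -- count the distinct steep vectors
  set D := R'.image V with hD_def
  have hDcard : D.card = R'.card := Finset.card_image_of_injOn hVinj
  have hDsteep : ∀ v ∈ D, 1 ≤ v.2 ∧ |v.1| ≤ v.2 := by
    intro v hv
    obtain ⟨p, hp, rfl⟩ := Finset.mem_image.1 hv
    exact hsteep p hp
  have hDsum : ∑ v ∈ D, v.2 ≤ N := by
    rw [hD_def, Finset.sum_image hVinj]
    exact hsumle
  have hcount := card_mul_le_of_steep D hDsteep J
  have hJ' : (N : ℤ) ≤ ((J : ℤ) + 1) ^ 3 := by exact_mod_cast hJ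
  -- `(J+1)·#D ≤ (J+1)((2J+1)J + (J+1)²)`, so `#D ≤ 3(J+1)²`
  have hD3 : (D.card : ℤ) ≤ 3 * ((J : ℤ) + 1) ^ 2 := by
    have hJ1 : (0 : ℤ) < (J : ℤ) + 1 := by positivity
    have h1 : ((J : ℤ) + 1) * D.card ≤ ((J : ℤ) + 1) * (((2 * J + 1) * J : ℕ) + ((J : ℤ) + 1) ^ 2) := by
      calc ((J : ℤ) + 1) * D.card ≤ ((J : ℤ) + 1) * ((2 * J + 1) * J : ℕ) + ∑ v ∈ D, v.2 := hcount
        _ ≤ ((J : ℤ) + 1) * ((2 * J + 1) * J : ℕ) + ((J : ℤ) + 1) ^ 3 := by linarith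
        _ = _ := by ring
    have h2 : (D.card : ℤ) ≤ ((2 * J + 1) * J : ℕ) + ((J : ℤ) + 1) ^ 2 := le_of_mul_le_mul_left h1 hJ1
    push_cast at h2
    nlinarith
  have hRcard : R.card = R'.card + 1 := by
    rw [hR'_def, Finset.card_erase_of_mem hpm]
    have := Finset.card_pos.2 hRne
    omega
  have : (R.card : ℤ) ≤ 3 * ((J : ℤ) + 1) ^ 2 + 1 := by
    rw [hRcard]; push_cast; rw [← hDcard]; linarith
  exact_mod_cast this

end TotalsLaw

end Summit.ValiantsHypothesis.ValiantsHypothesis.Theorems.NewtonUnitEquationsDissociatedUniform
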